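import Literature.Analysis.FluidPDE.Seregin2020CubicLowerBound
import Literature.Analysis.FluidPDE.SlabPressureNormalization
import HarnessLib

/-!
# Route `AxisTwistDoor`, crux `AveragedConeLiouville` (stmt-NavierStokesRegularity-26889) — INPUT N3 (`ShellFact` by the
# compactness–contradiction route), piece S4: STABILITY OF BOUNDEDNESS UNDER `L³_loc` CONVERGENCE OF TYPE I SLAB SOLUTIONS

N3 cut of record (pub/ns-inputs STATUS 2026-08-28T12:41:44Z, texts OK 12:52:02Z; `kits/N3-skeleton.lean` 815f0a7c119d2985,
`Sig.stability`; S4 re-assigned to this seat 13:31:08Z).  Let `(v_k, q_k)` be suitable weak solutions (`ν = 1`, `f = 0`) on the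
backward slab `(-∞,0) × ℝ³` with weak spatial gradients `G_k` and Albritton–Barker Type I quantity `𝐈 ≤ I₀ < ∞`, and let
`v_k → u` in `L³(Q(0,R₀))` for every `R₀`.  If `|u| ≤ M` a.e. on a cylinder `Q(z̄,R)` with `t̄ ≤ 0`, then `|v_k| ≤ B` a.e. on
`Q(z̄,R/2)` for all `k ≥ k₀`, with `B, k₀` depending on the data.

The proof is the body of the tree's `PersistenceOfSingularities_of_unforced` (Albritton–Barker 2019, Prop. 2.3 = Rusin–Šverák
2011, Lemma 2.1; `LocalTypeIPersistence.lean`) transplanted from the vertex `0` to a general vertex `z' ∈ Q(z̄,R/2)` with the slab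
as domain, every brick BY NAME:
* normalisation of the pressures by their unit-ball means (`IsSuitableWeakSolutionOn.sub_unitBallMean_slab`,
  `typeIBound_sub_unitBallMean`, `unitBallMean_sub_unitBallMean`) and the uniform pressure mass on `Q(0,a) ⊇ Q(z̄,R)`
  (`lintegral_pressure_le_of_unitBallMean_eq_zero`, `D ≤ 𝐈`), whence a starting bound `D_k(z',r₀) ≤ P` uniform in `k, z'`;
* the cubic term near a point where `u` is bounded (`cknC_le_of_ae_bound_of_lintegral_sub`) and the strong `L³` convergence
  (`tendsto_lintegral_cube_of_tendsto_eLpNorm`);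
* the proved pressure decay estimate iterated along the scales `θʲ r₀` (`seregin_sverak_pressure_decay_holds.ratio`,
  `cknD_iterate_le_of_pressure_decay`), so that `C_k(z',s) + D_k(z',s) ≤ ε₁³` at `s = θᴶ r₀` for `k ≥ k₀`, `k₀` UNIFORM in `z'`;
* the one-scale ε-regularity criterion at a general vertex (`Seregin2020.exists_epsilonRegularity_top`: `|v_k| ≤ C₀ ε₁ / s` a.e. on
  `Q(z',s/2)`);
* from the cylinders `Q(z',s/2)`, `z' ∈ Q(z̄,R/2)`, to a.e. on the open cylinder `Q(z̄,R/2)`: every point lies in `Q(z',s/2)` for the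
  raised centre `z' = (t + h, x)`, a countable subfamily covers (`TopologicalSpace.countable_cover_nhdsWithin`), and a.e. bounds on
  countably many pieces give an a.e. bound on the union (`ae_restrict_biUnion_iff`).

* **`stability`** — the piece (`Sig.stability` verbatim).

No NS statement is proved; N3 is an INPUT toward `ShellFact`; item 26889 and the summit stay OPEN.
`--supports stmt-NavierStokesRegularity-26889 --as helper`.
[cite: AlbrittonBarker2019, Prop. 2.3 and its proof (arXiv:1811.00502 p. 5); RusinSverak2011 Lemma 2.1 (arXiv:0911.0500 p. 4)]
-/

noncomputable section

-- the summit and its single sub-problem share the name (CONVENTIONS §1)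
set_option linter.dupNamespace false

open MeasureTheory Set Function Metric Filter Topology TopologicalSpace
open scoped NNReal ENNReal

namespace Summit.NavierStokesRegularity.NavierStokesRegularity.Theorems.AveragedConeLiouville.Shell

open Literature.Analysis Literature.Analysis.FluidPDE

set_option maxHeartbeats 1600000 in
/-- **S4 `stub_stability` of the N3 skeleton (`Sig.stability` verbatim): stability of boundedness under `L³_loc` convergence
of Type I slab solutions** (Albritton–Barker 2019, Prop. 2.3 / Rusin–Šverák 2011, Lemma 2.1, at a general vertex).
[cite: AlbrittonBarker2019, Prop. 2.3 and its proof (arXiv:1811.00502 p. 5); RusinSverak2011 Lemma 2.1 (arXiv:0911.0500 p. 4)] -/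
theorem stability :
    ∀ (I₀ : ℝ≥0∞), I₀ < ⊤ →
    ∀ (v : ℕ → ℝ → EuclideanSpace ℝ (Fin 3) → EuclideanSpace ℝ (Fin 3)) (q : ℕ → ℝ → EuclideanSpace ℝ (Fin 3) → ℝ)
      (G : ℕ → ℝ → EuclideanSpace ℝ (Fin 3) → EuclideanSpace ℝ (Fin 3) →L[ℝ] EuclideanSpace ℝ (Fin 3))
      (u : ℝ → EuclideanSpace ℝ (Fin 3) → EuclideanSpace ℝ (Fin 3)),
      (∀ k, IsSuitableWeakSolutionOn (slab (EuclideanSpace ℝ (Fin 3)) (Iio (0 : ℝ)) isOpen_Iio) 1 0 (v k) (q k)) →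
      (∀ k, HasWeakSpatialGradientOn (slab (EuclideanSpace ℝ (Fin 3)) (Iio (0 : ℝ)) isOpen_Iio) (v k) (G k)) →
      (∀ k, typeIBound (Iio (0 : ℝ) ×ˢ (univ : Set (EuclideanSpace ℝ (Fin 3)))) (v k) (q k) (G k) ≤ I₀) →
      (∀ R₀ : ℝ, 0 < R₀ → Tendsto (fun k => eLpNorm (uncurry (v k) - uncurry u) 3
          (volume.restrict (parabolicCylinder R₀ (0 : ℝ × EuclideanSpace ℝ (Fin 3))))) atTop (𝓝 0)) →
      ∀ (zbar : ℝ × EuclideanSpace ℝ (Fin 3)) (R M : ℝ), zbar.1 ≤ 0 → 0 < R →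
        (∀ᵐ w ∂(volume.restrict (parabolicCylinder R zbar)), ‖u w.1 w.2‖ ≤ M) →
        ∃ (B : ℝ) (k₀ : ℕ), ∀ k, k₀ ≤ k →
          ∀ᵐ w ∂(volume.restrict (parabolicCylinder (R / 2) zbar)), ‖v k w.1 w.2‖ ≤ B := by
  intro I₀ hI₀ v q G u hsw hwg hI hlim zbar R M hzbar hR hM
  have hI₀' : I₀ ≠ ∞ := hI₀.ne
  -- ### the normalised pressures `qn k = q k - [q k]_{B(0,1)}`
  obtain ⟨qn, hqn⟩ : ∃ qn : ℕ → ℝ → EuclideanSpace ℝ (Fin 3) → ℝ,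
      ∀ k, (fun t x => q k t x - ⨍ y in ball (0 : EuclideanSpace ℝ (Fin 3)) 1, q k t y) = qn k :=
    ⟨_, fun _ => rfl⟩
  have hloc : ∀ k, LocallyIntegrableOn (uncurry (q k))
      (Iio (0 : ℝ) ×ˢ (univ : Set (EuclideanSpace ℝ (Fin 3)))) volume :=
    fun k => (hsw k).distributional.2.2.1
  have hswn : ∀ k, IsSuitableWeakSolutionOn (slab (EuclideanSpace ℝ (Fin 3)) (Iio (0 : ℝ)) isOpen_Iio) 1 0
      (v k) (qn k) := fun k => by
    rw [← hqn k]; exact (hsw k).sub_unitBallMean_slab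
  have hIn : ∀ k, typeIBound (Iio (0 : ℝ) ×ˢ (univ : Set (EuclideanSpace ℝ (Fin 3)))) (v k) (qn k) (G k) ≤ I₀ :=
    fun k => by rw [← hqn k, typeIBound_sub_unitBallMean (hloc k)]; exact hI k
  have h0n : ∀ k t, ⨍ y in ball (0 : EuclideanSpace ℝ (Fin 3)) 1, qn k t y = 0 := fun k t => by
    rw [← hqn k]; exact unitBallMean_sub_unitBallMean (q k) t
  have hlocn : ∀ k, LocallyIntegrableOn (uncurry (qn k))
      (Iio (0 : ℝ) ×ˢ (univ : Set (EuclideanSpace ℝ (Fin 3)))) volume :=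
    fun k => (hswn k).distributional.2.2.1
  -- ### the constants of the pressure decay estimate and of the criterion
  obtain ⟨c, hPD⟩ := seregin_sverak_pressure_decay_holds.ratio
  obtain ⟨ε₁, C₀, hε₁, hC₀, hReg⟩ := Seregin2020.exists_epsilonRegularity_top
  obtain ⟨θ, hθ, hθhalf, hcθ⟩ := exists_ratio_mul_le_half c
  have hθ1 : θ ≤ 1 := hθhalf.trans (by norm_num)
  -- ### the sets: `S = Q(z̄,R)` where `u` is bounded, the big cylinder `Q(0,a) ⊇ S` carrying the `L³` convergence
  set S : Set (ℝ × EuclideanSpace ℝ (Fin 3)) := parabolicCylinder R zbar with hSdef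
  set Me : ℝ≥0∞ := ENNReal.ofReal M with hMe
  have hMb : ∀ᵐ w ∂(volume.restrict S), ‖u w.1 w.2‖ₑ ≤ Me := by
    filter_upwards [hM] with w hw
    rw [hMe, ← ofReal_norm]
    exact ENNReal.ofReal_le_ofReal hw
  set a : ℝ := 1 + R + R ^ 2 + |zbar.1| + ‖zbar.2‖ with hadef
  have habs : 0 ≤ |zbar.1| := abs_nonneg _
  have hnz : 0 ≤ ‖zbar.2‖ := norm_nonneg _
  have ha1 : 1 ≤ a := by rw [hadef]; nlinarith
  have ha0 : 0 < a := one_pos.trans_le ha1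
  have hSa : S ⊆ parabolicCylinder a (0 : ℝ × EuclideanSpace ℝ (Fin 3)) := by
    intro w hw
    rw [hSdef, mem_parabolicCylinder] at hw
    rw [mem_parabolicCylinder]
    refine ⟨⟨?_, ?_⟩, ?_⟩
    · have h1 : a ≤ a ^ 2 := by nlinarith
      have h2 : -|zbar.1| ≤ zbar.1 := neg_abs_le _
      show (0 : ℝ) - a ^ 2 < w.1
      linarith [hw.1.1]
    · show w.1 < 0
      exact lt_of_lt_of_le hw.1.2 hzbar
    · show dist w.2 (0 : EuclideanSpace ℝ (Fin 3)) < a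
      calc dist w.2 (0 : EuclideanSpace ℝ (Fin 3)) ≤ dist w.2 zbar.2 + dist zbar.2 0 := dist_triangle _ _ _
        _ < R + ‖zbar.2‖ := by rw [dist_zero_right]; linarith [hw.2]
        _ ≤ a := by rw [hadef]; nlinarith
  -- the strong `L³` convergence on `Q(0,a)`
  have hT : Tendsto (fun k => ∫⁻ w in parabolicCylinder a (0 : ℝ × EuclideanSpace ℝ (Fin 3)),
      ‖v k w.1 w.2 - u w.1 w.2‖ₑ ^ (3 : ℕ)) atTop (𝓝 0) :=
    tendsto_lintegral_cube_of_tendsto_eLpNorm (hlim a ha0)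
  -- the uniform pressure mass on `Q(0,a)`
  set Cp : ℝ≥0∞ := 2 * (1 + volume (ball (0 : EuclideanSpace ℝ (Fin 3)) a) *
      (volume (ball (0 : EuclideanSpace ℝ (Fin 3)) 1))⁻¹) * (ENNReal.ofReal a ^ 2 * I₀) with hCpdef
  have hCptop : Cp ≠ ∞ := by
    rw [hCpdef, ← mul_assoc]
    exact ENNReal.mul_ne_top (pressureConst_lt_top a).ne hI₀'
  have hCp : ∀ k, ∫⁻ w in parabolicCylinder a (0 : ℝ × EuclideanSpace ℝ (Fin 3)),
      ‖qn k w.1 w.2‖ₑ ^ (3 / 2 : ℝ) ≤ Cp := by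
    intro k
    refine (lintegral_pressure_le_of_unitBallMean_eq_zero (hlocn k) (h0n k) ha1).trans ?_
    rw [hCpdef]
    gcongr
    exact (cknDOsc_le_abScaledSum (u := v k) (G := G k)).trans
      ((abScaledSum_le_typeIBound ha0 (parabolicCylinder_subset_lowerHalf le_rfl a)).trans (hIn k))
  -- ### constants, exactly as in `PersistenceOfSingularities_of_unforced`
  set V₁ : ℝ≥0∞ := volume (ball (0 : EuclideanSpace ℝ (Fin 3)) 1) with hV₁
  have hV₁top : V₁ ≠ ∞ := measure_ball_lt_top.ne
  set Θ : ℝ≥0∞ := ENNReal.ofReal ((θ⁻¹) ^ 2) with hΘ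
  set L : ℝ≥0∞ := 1 + 2 * ((c : ℝ≥0∞) * Θ) with hL
  have hLtop : L ≠ ∞ := ENNReal.add_ne_top.2 ⟨ENNReal.one_ne_top,
    ENNReal.mul_ne_top ENNReal.ofNat_ne_top
      (ENNReal.mul_ne_top ENNReal.coe_ne_top ENNReal.ofReal_ne_top)⟩
  set ε : ℝ≥0∞ := ENNReal.ofReal (ε₁ ^ 3) with hεdef
  have hε4 : 0 < ε / 4 :=
    ENNReal.div_pos (ENNReal.ofReal_pos.2 (by positivity)).ne' ENNReal.ofNat_ne_top
  -- (A) the radius `r₀ ≤ R/2`: `L · 4 |B₁| M³ r₀³ ≤ ε/4`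
  obtain ⟨rA, hrA, hA⟩ := exists_forall_ofReal_pow_three_mul_le (N := L * (4 * (V₁ * Me ^ 3)))
    (ENNReal.mul_ne_top hLtop (ENNReal.mul_ne_top ENNReal.ofNat_ne_top
      (ENNReal.mul_ne_top hV₁top (ENNReal.pow_ne_top ENNReal.ofReal_ne_top)))) hε4
  set r₀ : ℝ := min (R / 2) rA with hr₀def
  have hr₀ : 0 < r₀ := lt_min (by positivity) hrA
  have hr₀R : r₀ ≤ R / 2 := min_le_left _ _
  have hAr₀ : ENNReal.ofReal (r₀ ^ 3) * (L * (4 * (V₁ * Me ^ 3))) ≤ ε / 4 :=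
    hA r₀ hr₀ (min_le_right _ _)
  -- (B) the number of steps `J`
  set P : ℝ≥0∞ := (ENNReal.ofReal r₀ ^ 2)⁻¹ * Cp with hPdef
  have hPtop : P ≠ ∞ :=
    ENNReal.mul_ne_top (ENNReal.inv_ne_top.2 (pow_ne_zero 2 (ENNReal.ofReal_pos.2 hr₀).ne')) hCptop
  obtain ⟨J, hJ⟩ := exists_inv_two_pow_mul_le hPtop hε4
  -- the final scale `s = θᴶ r₀`
  set s : ℝ := θ ^ J * r₀ with hsdef
  have hs : 0 < s := by positivity
  have hsr₀ : s ≤ r₀ := mul_le_of_le_one_left hr₀.le (pow_le_one₀ hθ.le hθ1)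
  have hscale0 : ∀ j : ℕ, 0 < θ ^ j * r₀ := fun j => by positivity
  have hscale1 : ∀ j : ℕ, θ ^ j * r₀ ≤ r₀ := fun j =>
    mul_le_of_le_one_left hr₀.le (pow_le_one₀ hθ.le hθ1)
  have hscale2 : ∀ j ≤ J, s ≤ θ ^ j * r₀ := fun j hj =>
    mul_le_mul_of_nonneg_right (pow_le_pow_of_le_one hθ.le hθ1 hj) hr₀.le
  -- ### large `k`: the `L³` distance on `Q(0,a)` is small — a condition UNIFORM in the vertex
  have hevT : ∀ᶠ k : ℕ in atTop, L * (4 * ((ENNReal.ofReal s ^ 2)⁻¹ *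
      ∫⁻ w in parabolicCylinder a (0 : ℝ × EuclideanSpace ℝ (Fin 3)),
        ‖v k w.1 w.2 - u w.1 w.2‖ₑ ^ (3 : ℕ))) ≤ ε / 4 := by
    have hfin : L * (4 * (ENNReal.ofReal s ^ 2)⁻¹) ≠ ∞ :=
      ENNReal.mul_ne_top hLtop (ENNReal.mul_ne_top ENNReal.ofNat_ne_top
        (ENNReal.inv_ne_top.2 (pow_ne_zero 2 (ENNReal.ofReal_pos.2 hs).ne')))
    have h1 := ENNReal.Tendsto.const_mul hT (Or.inr hfin)
    rw [mul_zero] at h1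
    have h2 : Tendsto (fun k : ℕ => L * (4 * ((ENNReal.ofReal s ^ 2)⁻¹ *
        ∫⁻ w in parabolicCylinder a (0 : ℝ × EuclideanSpace ℝ (Fin 3)),
          ‖v k w.1 w.2 - u w.1 w.2‖ₑ ^ (3 : ℕ)))) atTop (𝓝 0) := by
      refine h1.congr fun k => ?_
      simp only [mul_assoc]
    exact h2.eventually (ge_mem_nhds hε4)
  obtain ⟨k₀, hk₀⟩ := eventually_atTop.1 hevT
  refine ⟨C₀ * ε₁ / s, k₀, fun k hk => ?_⟩
  have hkT := hk₀ k hk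
  -- ### the bound at every vertex `z' ∈ Q(z̄,R/2)`, on `Q(z',s/2)`
  have hpt : ∀ z' ∈ parabolicCylinder (R / 2) zbar,
      ∀ᵐ w ∂(volume.restrict (parabolicCylinder (s / 2) z')), ‖v k w.1 w.2‖ ≤ C₀ * ε₁ / s := by
    intro z' hz'
    rw [mem_parabolicCylinder] at hz'
    have hz'0 : z'.1 ≤ 0 := (hz'.1.2.le).trans hzbar
    -- `Q(z',r₀) ⊆ S ⊆ Q(0,a)` and `Q(z',r₀) ⊆` the slab
    have hQS : parabolicCylinder r₀ z' ⊆ S := by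
      intro w hw
      rw [mem_parabolicCylinder] at hw
      rw [hSdef, mem_parabolicCylinder]
      have hr2 : r₀ ^ 2 ≤ (R / 2) ^ 2 := pow_le_pow_left₀ hr₀.le hr₀R 2
      refine ⟨⟨by nlinarith [hw.1.1, hz'.1.1], lt_trans hw.1.2 hz'.1.2⟩, ?_⟩
      calc dist w.2 zbar.2 ≤ dist w.2 z'.2 + dist z'.2 zbar.2 := dist_triangle _ _ _
        _ < r₀ + R / 2 := add_lt_add hw.2 hz'.2
        _ ≤ R := by linarith
    have hQsl : parabolicCylinder r₀ z' ⊆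
        (((slab (EuclideanSpace ℝ (Fin 3)) (Iio (0 : ℝ)) isOpen_Iio) : Opens (ℝ × EuclideanSpace ℝ (Fin 3))) :
          Set (ℝ × EuclideanSpace ℝ (Fin 3))) := parabolicCylinder_subset_slab r₀ hz'0
    -- the cubic inputs of the approximant `v k`
    set T : ℝ≥0∞ := ∫⁻ w in parabolicCylinder a (0 : ℝ × EuclideanSpace ℝ (Fin 3)),
      ‖v k w.1 w.2 - u w.1 w.2‖ₑ ^ (3 : ℕ) with hTdef
    set e : ℝ≥0∞ := 4 * (V₁ * Me ^ 3 * ENNReal.ofReal (r₀ ^ 3)) +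
      4 * ((ENNReal.ofReal s ^ 2)⁻¹ * T) with hedef
    have hCe : ∀ j ≤ J, cknC (θ ^ j * r₀) z' (v k) ≤ e := by
      intro j hj
      have hQjS : parabolicCylinder (θ ^ j * r₀) z' ⊆ S :=
        (parabolicCylinder_mono (hscale0 j).le (hscale1 j) z').trans hQS
      refine (cknC_le_of_ae_bound_of_lintegral_sub (hscale0 j) hQjS (hQjS.trans hSa) hMb le_rfl).trans ?_
      have h1 : ENNReal.ofReal ((θ ^ j * r₀) ^ 3) ≤ ENNReal.ofReal (r₀ ^ 3) :=
        ENNReal.ofReal_le_ofReal (pow_le_pow_left₀ (hscale0 j).le (hscale1 j) 3)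
      have h2 : (ENNReal.ofReal (θ ^ j * r₀) ^ 2)⁻¹ ≤ (ENNReal.ofReal s ^ 2)⁻¹ :=
        ENNReal.inv_le_inv.2 (pow_le_pow_left' (ENNReal.ofReal_le_ofReal (hscale2 j hj)) 2)
      rw [hedef]
      gcongr
    -- the pressure of the approximant at the last scale
    have hD : cknD s z' (qn k) ≤
        (2⁻¹ : ℝ≥0∞) ^ J * cknD r₀ z' (qn k) + 2 * ((c : ℝ≥0∞) * Θ * e) :=
      cknD_iterate_le_of_pressure_decay hPD hθ hθ1 hcθ (hswn k).distributional hr₀ hQsl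
        (fun j hj => hCe j hj.le)
    have hD0 : cknD r₀ z' (qn k) ≤ P :=
      (cknD_le_of_subset (qn k) (hQS.trans hSa)).trans (mul_le_mul_right (hCp k) _)
    -- smallness at the scale `s`
    have hsmall : cknC s z' (v k) + cknD s z' (qn k) ≤ ε := by
      have h1 : cknC s z' (v k) ≤ e := hCe J le_rfl
      have h2 : L * e ≤ ε / 4 + ε / 4 := by
        rw [hedef, mul_add]
        refine add_le_add ?_ hkT
        calc L * (4 * (V₁ * Me ^ 3 * ENNReal.ofReal (r₀ ^ 3)))
            = ENNReal.ofReal (r₀ ^ 3) * (L * (4 * (V₁ * Me ^ 3))) := by ring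
          _ ≤ ε / 4 := hAr₀
      have h3 : (2⁻¹ : ℝ≥0∞) ^ J * cknD r₀ z' (qn k) ≤ ε / 4 := le_trans (by gcongr) hJ
      calc cknC s z' (v k) + cknD s z' (qn k)
          ≤ e + ((2⁻¹ : ℝ≥0∞) ^ J * cknD r₀ z' (qn k) + 2 * ((c : ℝ≥0∞) * Θ * e)) := add_le_add h1 hD
        _ = L * e + (2⁻¹ : ℝ≥0∞) ^ J * cknD r₀ z' (qn k) := by rw [hL]; ring
        _ ≤ (ε / 4 + ε / 4) + ε / 4 := add_le_add h2 h3
        _ ≤ ε := ENNReal.add_quarters_le ε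
    -- finiteness of `A, E, D` at the top scale `r₀` (Type I bound and the uniform pressure mass)
    have hsum : abScaledSum r₀ z' (v k) (qn k) (G k) ≤ I₀ :=
      (abScaledSum_le_typeIBound hr₀ (parabolicCylinder_subset_lowerHalf hz'0 r₀)).trans (hIn k)
    have hAfin : cknAEss r₀ z' (v k) ≠ ∞ := ne_top_of_le_ne_top hI₀' (cknAEss_le_abScaledSum.trans hsum)
    have hEfin : cknE r₀ z' (G k) ≠ ∞ := ne_top_of_le_ne_top hI₀' (cknE_le_abScaledSum.trans hsum)
    have hDfin : cknD r₀ z' (qn k) ≠ ∞ := ne_top_of_le_ne_top hPtop hD0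
    -- the one-scale criterion at the vertex `z'`
    exact hReg _ (v k) (qn k) (G k) (hswn k) (hwg k) z' r₀ hr₀ hQsl hAfin hEfin hDfin s ε₁ hs hsr₀
      hε₁.le le_rfl hsmall
  -- ### from the cylinders `Q(z',s/2)` to a.e. on the open cylinder `Q(z̄,R/2)`
  set U : Set (ℝ × EuclideanSpace ℝ (Fin 3)) := parabolicCylinder (R / 2) zbar with hUdef
  -- the raised centre of a point of `U`
  set ctr : ℝ × EuclideanSpace ℝ (Fin 3) → ℝ × EuclideanSpace ℝ (Fin 3) :=
    fun w => (w.1 + min (s ^ 2 / 8) ((zbar.1 - w.1) / 2), w.2) with hctr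
  have hctrU : ∀ w ∈ U, ctr w ∈ U := by
    intro w hw
    rw [hUdef, mem_parabolicCylinder] at hw
    rw [hUdef, mem_parabolicCylinder, hctr]
    dsimp only
    have hmin1 : min (s ^ 2 / 8) ((zbar.1 - w.1) / 2) ≤ (zbar.1 - w.1) / 2 := min_le_right _ _
    have hmin0 : 0 < min (s ^ 2 / 8) ((zbar.1 - w.1) / 2) := lt_min (by positivity) (by linarith [hw.1.2])
    exact ⟨⟨by linarith [hw.1.1], by linarith [hw.1.2]⟩, hw.2⟩
  have hwQ : ∀ w ∈ U, w ∈ parabolicCylinder (s / 2) (ctr w) := by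
    intro w hw
    rw [hUdef, mem_parabolicCylinder] at hw
    rw [mem_parabolicCylinder, hctr]
    dsimp only
    have hmin2 : min (s ^ 2 / 8) ((zbar.1 - w.1) / 2) ≤ s ^ 2 / 8 := min_le_left _ _
    have hmin0 : 0 < min (s ^ 2 / 8) ((zbar.1 - w.1) / 2) := lt_min (by positivity) (by linarith [hw.1.2])
    refine ⟨⟨by nlinarith [hs], by linarith⟩, ?_⟩
    rw [dist_self]; positivity
  obtain ⟨t, htU, htc, hcover⟩ := TopologicalSpace.countable_cover_nhdsWithin
    (f := fun w => parabolicCylinder (s / 2) (ctr w)) (s := U)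
    (fun w hw => mem_nhdsWithin_of_mem_nhds ((isOpen_parabolicCylinder _ _).mem_nhds (hwQ w hw)))
  have hunion : ∀ᵐ w ∂(volume.restrict (⋃ w ∈ t, parabolicCylinder (s / 2) (ctr w))),
      ‖v k w.1 w.2‖ ≤ C₀ * ε₁ / s := by
    rw [ae_restrict_biUnion_iff _ htc]
    intro w hw
    exact hpt (ctr w) (hctrU w (htU hw))
  exact ae_restrict_of_ae_restrict_of_subset hcover hunion

end Summit.NavierStokesRegularity.NavierStokesRegularity.Theorems.AveragedConeLiouville.Shell

end
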